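import Mathlib

set_option linter.dupNamespace false
set_option autoImplicit false

/-!
# Obstruction descent — universal occurrence, XVIII: the graded escape lemma (ring-theoretic core of the
# 3-SLICE SATURATION LAW at Strassen's hypersurface)

Route `ObstructionDescent`, crux `NoOccurrenceObstruction` (`P_O`, stmt 29040), instrument `UOCC(m,N)` / `u(N)` (decomp-mm, lens 3,
NODE-g39 §3).  The critic (g17, ask FIRST for g39) proposed the Kronecker-multiplicity-2 type `κ₇ = ((7,7,7),(3⁷),(3⁷))` of
Strassen's degree-21 equation `F₇` of `σ₁₀(ℂ³⊗ℂ⁷⊗ℂ⁷)` as the first candidate occurrence-obstruction cell able to leave the `3N/2`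
wall.  NODE-g39 §3 settles it negatively and proves the general law below; this file kernel-checks its one non-citational step.

THE 3-SLICE SATURATION LAW (NODE-g39 §3; `n ≥ 3` odd, `r_n = (3n−1)/2`, `κ_n = ((n,n,n),(3ⁿ),(3ⁿ))`).  By Strassen's theorem
[BurgisserClausenShokrollahi1997, Thm. (19.17), Lemma (19.16), Prop. (20.20)] the tensors of format `(3,n,n)` of border rank
`≤ r_n` form an IRREDUCIBLE HYPERSURFACE whose ideal is generated by the IRREDUCIBLE relative invariant `F_n` (degree `n` in each
slice set, weight `κ_n`).  Hence for every partition triple `λ ⊢ d` fitting `(3,n,n)`, the highest-weight vectors of type `λ`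
vanishing on `σ_{r_n}` are exactly `F_n · HWV_{λ−κ_n}`, of dimension `g(λ−κ_n)` (Kronecker coefficient; `0` if `λ−κ_n` is not a
triple of partitions), and
    `λ ∉ S(⟨r_n⟩)  ⟺  g(λ) = g(λ − κ_n)`                                                               (†)
(`S` = Bürgisser–Ikenmeyer occurrence semigroup; "⟸/⟹" via inheritance to format `(3,n,n)` and `occurs_unitTensor_of_algBorderRank_le`).
* `n = 3, 5`: `g(κ_n) = 1`, and (†) holds for `λ = κ_n`: these are EXACTLY the tree's Strassen cell `(4,3)` (part XIV, `…Three`) and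
  Koszul cell `(7,5)` (part XV, `…KoszulFive`) — one mechanism, "every HWV of the type is an `F_n`-multiple".
* `n ≥ 7`: `g(κ_n) ≥ 2` (`g(κ_7) = 2`, `g(κ_9) = 3`, `g(κ_11) = 4`, `g(κ_13) = 5`; NODE-g39 `calc/kappa_values.out`, characters), so a
  second highest-weight vector `F'` of weight `κ_n`, NOT divisible by `F_n`, exists, and THIS FILE's `finrank_lt_of_gradedEscape`
  gives `g(μ + κ_n) ≥ g(μ) + 1` whenever `g(μ) > 0` — so (†) never holds: **for every odd `n ≥ 7` (with `g(κ_n) ≥ 2`) EVERY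
  Kronecker-positive triple fitting `(3,n,n)` occurs in `S(⟨(3n−1)/2⟩)`.**  At Strassen's hypersurface the equation method proves
  `bR > r_n` for the generic 3-slice tensor while NO occurrence obstruction exists for ANY 3-slice tensor; 3-slice types (in any leg
  order) contribute no cell at `m ≥ (3n−1)/2`, and by the fill `σ_{r_n+1}(3,n,n) = everything` none above — the proposed `g = 2` cells
  cannot leave the `3N/2` wall, and for `n ≥ 7` they are not cells at all.

THE DICTIONARY for the theorems below: `R = ℂ[ℂ³⊗ℂⁿ⊗ℂⁿ]` (a UFD, so `WfDvdMonoid`); `W = ℤ³ × ℤⁿ × ℤⁿ`; `V w` = the polynomials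
fixed by the three lower-unitriangular groups and of torus weight `w` (so `dim V λ = g(λ)` for dominant `λ ⊢ d` fitting `(3,n,n)`,
Schur–Weyl); graded multiplication `V a · V b ⊆ V (a+b)`; `F = F_n ∈ V κ_n`, prime (irreducible in a UFD); `F' ∈ V κ_n` with
`F ∤ F'`; weight descent `F·x ∈ V (w+κ) ⟹ x ∈ V w` (if `F x` is `U`-fixed then `F·(u x) = u(F x) = F x`, so `u x = x` in the domain
`R`; weights subtract).  Conclusion `finrank (V μ) < finrank (V (μ+κ))` whenever `V μ ≠ 0` = the inequality `g(μ+κ_n) > g(μ)`.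

Contents: `not_dvd_pow_mul` (a prime misses `F'^k·h₀` if it misses `F'` and `h₀`); `exists_eq_pow_mul_not_dvd` (escape
factorisation `h = F^j h₀`, `F ∤ h₀`, in a `WfDvdMonoid`); `mem_of_pow_mul_mem` (weight descent iterated); `exists_mem_not_dvd_of_gradedEscape`
(a nonzero element of `V (μ+κ)` outside `F·R`, from any nonzero element of `V μ`); `finrank_lt_of_gradedEscape` (strict growth of
graded dimensions along `κ`).  Pure commutative algebra over Mathlib; no proposition is defined; no `def`; sorry-free; standard axioms;
nothing here closes an item.  [cite: BurgisserClausenShokrollahi1997, Lemma (19.16), Thm. (19.17), Prop. (20.20)]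
[cite: BurgisserIkenmeyer2011, §3.2, §4, Lemma 6.1] [cite: Strassen1983, §4]
-/

namespace Summit.MatrixMultiplication.MatrixMultiplication.Theorems.ObstructionCalculus

open Module

/-! ## §1  Escape from a prime -/

/-- A prime `F` that divides neither `F'` nor `h₀` divides no `F' ^ k * h₀`. -/
theorem not_dvd_pow_mul {R : Type*} [CommMonoidWithZero R] {F F' h₀ : R} (hF : Prime F) (hFF' : ¬ F ∣ F')
    (hh₀ : ¬ F ∣ h₀) (k : ℕ) : ¬ F ∣ F' ^ k * h₀ := by
  intro hdvd
  rcases hF.dvd_or_dvd hdvd with h | h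
  · exact hFF' (hF.dvd_of_dvd_pow h)
  · exact hh₀ h

/-- **Escape factorisation**: in a monoid with well-founded divisibility every nonzero `h` is `F ^ j * h₀` with `F ∤ h₀`
(for a non-unit `F`). -/
theorem exists_eq_pow_mul_not_dvd {R : Type*} [CommMonoidWithZero R] [WfDvdMonoid R] {F h : R} (hF : ¬ IsUnit F)
    (hh : h ≠ 0) : ∃ (j : ℕ) (h₀ : R), h = F ^ j * h₀ ∧ ¬ F ∣ h₀ := by
  obtain ⟨j, h₀, hnd, rfl⟩ := WfDvdMonoid.max_power_factor' hh hF
  exact ⟨j, h₀, rfl, hnd⟩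

/-! ## §2  Graded pieces: weight descent and the escaping element -/

/-- **Weight descent, iterated**: if `F · x ∈ V (w + κ)` forces `x ∈ V w`, then `F ^ j · x ∈ V (w + j • κ)` forces `x ∈ V w`. -/
theorem mem_of_pow_mul_mem {K R W : Type*} [Field K] [CommRing R] [Algebra K R] [AddCommGroup W]
    (V : W → Submodule K R) {F : R} {κ : W}
    (hdesc : ∀ (w : W) (x : R), F * x ∈ V (w + κ) → x ∈ V w) :
    ∀ (j : ℕ) (w : W) (x : R), F ^ j * x ∈ V (w + j • κ) → x ∈ V w := by
  intro j
  induction j with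
  | zero => intro w x hx; simpa using hx
  | succ j ih =>
      intro w x hx
      have hx' : F * (F ^ j * x) ∈ V ((w + j • κ) + κ) := by
        have : F ^ (j + 1) * x = F * (F ^ j * x) := by ring
        rw [← this]
        convert hx using 2
        rw [add_smul, one_smul, add_assoc]
      exact ih w x (hdesc _ _ hx')

/-- **The escaping element.**  Graded pieces `V : W → Submodule K R` of a domain `R` with well-founded divisibility, closed under
multiplication (`V a · V b ⊆ V (a + b)`) and with weight descent along a PRIME `F` of weight `κ`; if a second element `F' ∈ V κ` is
not divisible by `F`, then above every nonzero `h ∈ V μ` there is a NONZERO element of `V (μ + κ)` NOT divisible by `F`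
(namely `F' ^ (j+1) · h₀` for the escape factorisation `h = F ^ j · h₀`).  [cite: BurgisserClausenShokrollahi1997, Lemma (19.16)] -/
theorem exists_mem_not_dvd_of_gradedEscape {K R W : Type*} [Field K] [CommRing R] [IsDomain R] [WfDvdMonoid R] [Algebra K R]
    [AddCommGroup W] (V : W → Submodule K R) {F F' : R} {κ : W} (hF : Prime F) (hF' : F' ∈ V κ) (hFF' : ¬ F ∣ F')
    (hmul : ∀ (a b : W) (x y : R), x ∈ V a → y ∈ V b → x * y ∈ V (a + b))
    (hdesc : ∀ (w : W) (x : R), F * x ∈ V (w + κ) → x ∈ V w)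
    {μ : W} {h : R} (hh : h ∈ V μ) (hh0 : h ≠ 0) :
    ∃ y : R, y ∈ V (μ + κ) ∧ y ≠ 0 ∧ ¬ F ∣ y := by
  obtain ⟨j, h₀, rfl, hnd⟩ := exists_eq_pow_mul_not_dvd hF.not_unit hh0
  have hh₀ : h₀ ∈ V (μ - j • κ) :=
    mem_of_pow_mul_mem V hdesc j (μ - j • κ) h₀ (by simpa using hh)
  have hpow : ∀ k : ℕ, F' ^ (k + 1) ∈ V ((k + 1) • κ) := by
    intro k
    induction k with
    | zero => simpa using hF'
    | succ k ih =>
        have hk := hmul ((k + 1) • κ) κ (F' ^ (k + 1)) F' ih hF'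
        have e1 : F' ^ (k + 1) * F' = F' ^ (k + 1 + 1) := by ring
        have e2 : (k + 1) • κ + κ = (k + 1 + 1) • κ := by rw [add_smul ((k : ℕ) + 1) 1 κ, one_smul]
        rw [e1, e2] at hk
        exact hk
  refine ⟨F' ^ (j + 1) * h₀, ?_, ?_, not_dvd_pow_mul hF hFF' hnd (j + 1)⟩
  · have hk := hmul ((j + 1) • κ) (μ - j • κ) _ _ (hpow j) hh₀
    have e : (j + 1) • κ + (μ - j • κ) = μ + κ := by rw [add_smul, one_smul]; abel
    rw [e] at hk
    exact hk
  · have hF'0 : F' ≠ 0 := by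
      rintro rfl
      exact hFF' (dvd_zero F)
    have hh₀0 : h₀ ≠ 0 := by
      rintro rfl
      simp at hh0
    exact mul_ne_zero (pow_ne_zero _ hF'0) hh₀0

/-! ## §3  Strict growth of graded dimensions along `κ` -/

/-- **Strict growth of graded dimensions** (the inequality `g(μ + κ_n) ≥ g(μ) + 1` of the 3-slice saturation law, in abstract
form).  Under the hypotheses of `exists_mem_not_dvd_of_gradedEscape` and `F ∈ V κ`: multiplication by `F` embeds `V μ` into
`V (μ + κ)` (domain) and misses the escaping element, so `finrank (V μ) < finrank (V (μ + κ))` as soon as `V μ` has a nonzero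
element (and `V (μ + κ)` is finite-dimensional).  [cite: BurgisserClausenShokrollahi1997, Lemma (19.16), Thm. (19.17)] -/
theorem finrank_lt_of_gradedEscape {K R W : Type*} [Field K] [CommRing R] [IsDomain R] [WfDvdMonoid R] [Algebra K R]
    [AddCommGroup W] (V : W → Submodule K R) {F F' : R} {κ : W} (hF : Prime F) (hFκ : F ∈ V κ) (hF' : F' ∈ V κ)
    (hFF' : ¬ F ∣ F')
    (hmul : ∀ (a b : W) (x y : R), x ∈ V a → y ∈ V b → x * y ∈ V (a + b))
    (hdesc : ∀ (w : W) (x : R), F * x ∈ V (w + κ) → x ∈ V w)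
    {μ : W} (hne : ∃ h ∈ V μ, h ≠ 0) [Module.Finite K (V (μ + κ))] :
    finrank K (V μ) < finrank K (V (μ + κ)) := by
  obtain ⟨h, hh, hh0⟩ := hne
  obtain ⟨y, hy, -, hynd⟩ := exists_mem_not_dvd_of_gradedEscape V hF hF' hFF' hmul hdesc hh hh0
  have hmem : ∀ x : V μ, F * (x : R) ∈ V (μ + κ) := fun x => by
    have hk := hmul κ μ F x hFκ x.2
    rwa [add_comm] at hk
  let f : V μ →ₗ[K] V (μ + κ) :=
    { toFun := fun x => ⟨F * (x : R), hmem x⟩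
      map_add' := fun x y => by
        ext
        simp [mul_add]
      map_smul' := fun c x => by
        ext
        simp }
  have hf : ∀ x : V μ, ((f x : V (μ + κ)) : R) = F * (x : R) := fun x => rfl
  have hinj : Function.Injective f := by
    intro x₁ x₂ hx
    have h' : F * (x₁ : R) = F * (x₂ : R) := by rw [← hf, ← hf, hx]
    exact Subtype.ext (mul_left_cancel₀ hF.ne_zero h')
  have hrange : finrank K (LinearMap.range f) = finrank K (V μ) := LinearMap.finrank_range_of_inj hinj
  have hlt : LinearMap.range f < ⊤ := by
    refine lt_top_iff_ne_top.2 fun htop => hynd ?_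
    have hyr : (⟨y, hy⟩ : V (μ + κ)) ∈ LinearMap.range f := by
      rw [htop]
      exact Submodule.mem_top
    obtain ⟨x, hx⟩ := hyr
    refine ⟨(x : R), ?_⟩
    have h' := congrArg (fun z : V (μ + κ) => (z : R)) hx
    simp only [hf] at h'
    exact h'.symm
  calc finrank K (V μ) = finrank K (LinearMap.range f) := hrange.symm
    _ < finrank K (⊤ : Submodule K (V (μ + κ))) := Submodule.finrank_lt_finrank_of_lt hlt
    _ = finrank K (V (μ + κ)) := finrank_top K _

end Summit.MatrixMultiplication.MatrixMultiplication.Theorems.ObstructionCalculus
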